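import Literature.Geometry.Riemannian.RicciFlowScalarCurvatureProofs
import Literature.Geometry.Lorentzian.LeviCivitaProofs
import Literature.Geometry.Lorentzian.PseudoRiemannianMetricProofs
import HarnessLib

/-!
# `Ric ≥ (S/n) g` forces `Ric = (S/n) g` (the trace step of the compact shrinker classification)

A pointwise linear-algebra step of the classification of compact shrinking Ricci solitons by the
tensor maximum principle (Eminenti–La Nave–Mantegazza 2008, §3, p. 7: "`λ_min(p) = R/n` and since
we are in the point of minimum, `R_{ij} ≥ R g_{ij}/n` on the whole manifold. But this inequality
easily implies that `(M, g)` is an Einstein manifold"): for a Riemannian metric, a symmetric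
bilinear form `B` on a tangent space with `B(v,v) ≥ 0` for all `v` and `tr_g B = 0` vanishes
(`bilinForm_eq_zero_of_nonneg_of_trace_eq_zero`: in a `g`-orthonormal basis the diagonal entries
are non-negative with zero sum, hence zero, and a positive semidefinite symmetric form with zero
diagonal entry `B(e,e) = 0` has `B(e, ·) = 0`); applied to `B = Ric − (S/n) g`
(`ricci_eq_smul_of_forall_le`): **`Ric(v,v) ≥ (S/n)|v|²` for all `v ∈ T_xM` implies
`Ric_x = (S(x)/n) g_x`**. Together with Schur's lemma this makes `g` Einstein.

Everything is proved; no definitions of `Prop` type are introduced.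

## References

* M. Eminenti, G. La Nave, C. Mantegazza, *Ricci solitons: the equation point of view*,
  manuscripta math. 127 (2008), §3 (p. 7). [EminentiLanaveMantegazza2008]
* B. O'Neill, *Semi-Riemannian geometry with applications to relativity*, 1983, Ch. 2, Lemma 24
  and Ch. 3, Def. 3.53. [ONeill1983]
-/

noncomputable section

open Bundle Set Function Module
open scoped Manifold ContDiff

namespace Literature.Geometry.Riemannian

open Lorentzian Lorentzian.PseudoRiemannianMetric

variable {E : Type*} [NormedAddCommGroup E] [NormedSpace ℝ E] {H : Type*} [TopologicalSpace H]
  {I : ModelWithCorners ℝ E H} {M : Type*} [TopologicalSpace M] [ChartedSpace H M]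
  [IsManifold I ∞ M] {n : ℕ∞ω} [FiniteDimensional ℝ E]
  (g : PseudoRiemannianMetric I n E (TangentSpace I : M → Type _))

/-- **A positive semidefinite symmetric form with `B(e,e) = 0` has `B(e, ·) = 0`** (the quadratic
polynomial `t ↦ B(e + tw, e + tw) = 2t B(e,w) + t² B(w,w) ≥ 0` has no linear term). [folklore] -/
theorem bilinForm_apply_eq_zero_of_nonneg_of_apply_self_eq_zero {V : Type*} [AddCommGroup V]
    [Module ℝ V] (B : LinearMap.BilinForm ℝ V) (hsymm : ∀ v w, B v w = B w v)
    (hB : ∀ v, 0 ≤ B v v) {e : V} (he : B e e = 0) (w : V) : B e w = 0 := by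
  by_contra hc
  set c := B e w with hcdef
  set a := B w w with hadef
  have ha : 0 ≤ a := hB w
  have hexp : ∀ t : ℝ, 0 ≤ 2 * t * c + t ^ 2 * a := fun t ↦ by
    have h := hB (e + t • w)
    have : B (e + t • w) (e + t • w) = B e e + 2 * t * B e w + t ^ 2 * B w w := by
      simp only [map_add, map_smul, LinearMap.add_apply, LinearMap.smul_apply, smul_eq_mul,
        hsymm w e]
      ring
    rw [this, he] at h
    linarith
  have h1 := hexp (-c / (a + 1))
  have ha1 : 0 < a + 1 := by linarith
  have hkey : 2 * (-c / (a + 1)) * c + (-c / (a + 1)) ^ 2 * a = -(c ^ 2 * (a + 2)) / (a + 1) ^ 2 := by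
    field_simp
    ring
  rw [hkey] at h1
  have hc2 : 0 < c ^ 2 := by positivity
  have hnum : 0 < c ^ 2 * (a + 2) := by positivity
  have : -(c ^ 2 * (a + 2)) / (a + 1) ^ 2 < 0 :=
    div_neg_of_neg_of_pos (by linarith) (by positivity)
  linarith

/-- **A non-negative symmetric form with zero metric trace vanishes** (Riemannian fibre): in a
`g_x`-orthonormal basis `tr_g B = Σ B(eᵢ,eᵢ)` with non-negative summands.
[cite: ONeill1983, Ch. 3, Def. 3.53] [cite: EminentiLanaveMantegazza2008, §3 (p. 7)] -/
theorem bilinForm_eq_zero_of_nonneg_of_trace_eq_zero {x : M}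
    (hpos : ∀ v : TangentSpace I x, v ≠ 0 → 0 < g.val x v v)
    (B : LinearMap.BilinForm ℝ (TangentSpace I x)) (hsymm : ∀ v w, B v w = B w v)
    (hB : ∀ v, 0 ≤ B v v) (htr : g.trace x B = 0) : B = 0 := by
  obtain ⟨b, hb⟩ := g.exists_basis_isOrthonormalFrame (x := x) hpos rfl
  rw [g.trace_eq_sum_of_isOrthonormalFrame b hb B] at htr
  have hdiag : ∀ i, B (b i) (b i) = 0 := fun i ↦
    (Finset.sum_eq_zero_iff_of_nonneg fun j _ ↦ hB (b j)).mp htr i (Finset.mem_univ i)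
  have hrow : ∀ i w, B (b i) w = 0 := fun i w ↦
    bilinForm_apply_eq_zero_of_nonneg_of_apply_self_eq_zero B hsymm hB (hdiag i) w
  refine LinearMap.ext₂ fun v w ↦ ?_
  rw [← b.sum_repr v, map_sum]
  simp only [LinearMap.coe_sum, Finset.sum_apply, map_smul, LinearMap.smul_apply, smul_eq_mul,
    hrow, mul_zero, Finset.sum_const_zero, LinearMap.zero_apply]

variable [Fact (1 ≤ n)] [CompleteSpace E] [g.HasLeviCivita]

/-- **`Ric ≥ (S/n) g` at a point forces `Ric = (S/n) g` there** (Eminenti–La Nave–Mantegazza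
2008, §3, p. 7: the easy implication from `R_{ij} ≥ R g_{ij}/n` to Einstein, pointwise part): for
a Riemannian `C^n` metric, `n ≥ 2`, if `Ric_x(v,v) ≥ (S(x)/dim) g_x(v,v)` for all `v`, then
`Ric_x = (S(x)/dim) g_x` (`B = Ric − (S/dim) g` is non-negative, symmetric, and traceless).
[cite: EminentiLanaveMantegazza2008, §3 (p. 7)] -/
theorem ricci_eq_smul_of_forall_le (hn : 2 ≤ n) {x : M}
    (hpos : ∀ v : TangentSpace I x, v ≠ 0 → 0 < g.val x v v)
    (hle : ∀ v : TangentSpace I x,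
      g.scalarCurvature x / finrank ℝ E * g.val x v v ≤ g.ricci x v v)
    (X Y : TangentSpace I x) :
    g.ricci x X Y = g.scalarCurvature x / finrank ℝ E * g.val x X Y := by
  set c : ℝ := g.scalarCurvature x / finrank ℝ E with hc
  set B : LinearMap.BilinForm ℝ (TangentSpace I x) := g.ricci x - c • g.toBilinForm x with hBdef
  have hBapp : ∀ v w, B v w = g.ricci x v w - c * g.val x v w := fun v w ↦ by
    simp [hBdef]
  have hRs : ∀ v w : TangentSpace I x, g.ricci x v w = g.ricci x w v := fun v w ↦
    (g.ricci_symm_holds hn x).eq v w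
  have hsymm : ∀ v w, B v w = B w v := fun v w ↦ by
    rw [hBapp, hBapp, hRs v w, g.symm x v w]
  have hB : ∀ v, 0 ≤ B v v := fun v ↦ by rw [hBapp]; linarith [hle v]
  have htr : g.trace x B = 0 := by
    have h1 : g.trace x B = g.trace x (g.ricci x) - c * g.trace x (g.toBilinForm x) := by
      simp only [hBdef, PseudoRiemannianMetric.trace, LinearMap.comp_sub, LinearMap.comp_smul,
        map_sub, map_smul, smul_eq_mul]
    rw [h1, g.trace_toBilinForm_eq, ← scalarCurvature]
    rcases Nat.eq_zero_or_pos (finrank ℝ E) with h0 | hp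
    · obtain ⟨b0, hb0⟩ := g.exists_basis_isOrthonormalFrame (x := x) hpos h0
      rw [scalarCurvature, g.trace_eq_sum_of_isOrthonormalFrame b0 hb0]
      simp [h0]
    · have hn0 : (finrank ℝ E : ℝ) ≠ 0 := by exact_mod_cast hp.ne'
      rw [hc]
      field_simp
      ring
  have hB0 := bilinForm_eq_zero_of_nonneg_of_trace_eq_zero g hpos B hsymm hB htr
  have := hBapp X Y
  rw [hB0, LinearMap.zero_apply, LinearMap.zero_apply] at this
  linarith

end Literature.Geometry.Riemannian

end
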